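import Literature.MathematicalPhysics.QuantumFieldTheory.Balaban1983to89.B15BasicStep
import Literature.MathematicalPhysics.QuantumFieldTheory.Balaban1983to89.B15Ineq194Flow
import Literature.MathematicalPhysics.QuantumFieldTheory.Balaban1983to89.B15Claim179Flow

/-!
# `Balaban1983to89.B15Claim192Flow` — [Balaban1989LargeFieldI] p. 192: the two cumulation chains *"δ′_j ≦ (1 + β₀)²
# (k − j)^{β₀}δ′_k ≦ (1 + β₀)²N₀^{β₀}δ′_k, so N₀δ′_j ≦ (1 + β₀)²N₀^{1+β₀}δ′_k < 4N₀²δ′_k"* and *"L^{N₀−1} = R_{k−N₀+1} ≦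
# (L + 1)(N₀ + 1)^{β₀}R_k … L₀^{2N₀} ≦ (1/3)^{N₀}L(L + 1)(N₀ + 1)^{β₀}R_k < L(L + 1)N₀^{−1}R_k"* PROVED along any
# renormalization group flow of the [III] setting (b01's scalar last steps `n0_delta_bound` ∕ `n0_growth` BY NAME)

statement-level skeleton of published theorems with citation tags; proofs where landed; nothing here is a claim about
the Yang–Mills mass gap.

CITATION HEADER (lean-in-tree rule 2026-08-18).  T. Bałaban, *Large field renormalization. I. The basic step of the 𝐑
operation*, Commun. Math. Phys. **122**, 175–202 (1989), doi:10.1007/BF01257412, bib `Balaban1989LargeFieldI` (cell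
paper B15; PDF held `paper:balaban1989-cmp122-large-field-i`, journal page = PDF page + 174; p. 192 READ AS AN IMAGE on
the x2 render `run/shared/lean/pub/pub-balaban/b2b-balaban-ref1/pages/1989-cmp122-large-field-I/…-p018-x2.png`; p. 191
for `L₀² ≦ (1/3)L`).  [III] = [Balaban1988Convergent] (cell paper B14): (2.5) p. 255 = `B14.IsRj`, (2.8)/(2.9) p. 256 =
`B14.FlowIneq28` ∕ `B14FlowStep.FlowIneq29` and their third members `B14FlowStep.third_members`, all obtained along a
flow by `B14FlowStep.flowControl_of_betaSign`.  WHAT IS REPRODUCED: SKELETON row `B15.Claim@192` (p. 192 cumulation),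
unit `lit-balaban-r12` gen 8 (reader/typer and fold owner of block B15, Phase 2 in own block), HOME
`run/shared/lean/pub/lit-balaban/` (`lit-balaban-r12/ROWS-B15.md`).  Used BY NAME: `B15.BasicStep.n0_delta_bound`
(`(1+β₀)²N₀^{1+β₀} < 4N₀²`), `B15.BasicStep.n0_growth` (`N₀(N₀+1) < 3^{N₀}`), `B15.Ineq194Flow.deltaPrimeK` (`δ′_j`),
`B15Claim179.IsN0` ∕ `Eq179` (the `N₀`-equation), `B15Claim179Flow.exp_anti`.

THE PRINTED TEXT (p. 192, verbatim): *"More precisely, the bounds of the terms involve δ′_j, but δ′_j ≦ (1 + β₀)²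
(k − j)^{β₀}δ′_k ≦ (1 + β₀)²N₀^{β₀}δ′_k, so N₀δ′_j ≦ (1 + β₀)²N₀^{1+β₀}δ′_k < 4N₀²δ′_k, and we assume that N₀² makes only a
logarithmic contribution to δ′_k, e.g., N₀ = O(log g_k⁻²). In fact we will see that it is smaller."* … *"In these
definitions there are powers of L₀², the highest power appearing is k − k₀ = N₀. This number is defined by the equality
L^{−N₀+1}R_{k−N₀+1} = 1, from which we get L^{N₀−1} = R_{k−N₀+1} ≦ (L + 1)(N₀ + 1)^{β₀}R_k. The number L₀ satisfies the
restriction L₀² ≦ (1/3)L, hence L₀^{2N₀} ≦ (1/3)^{N₀}L(L + 1)(N₀ + 1)^{β₀}R_k < L(L + 1)N₀^{−1}R_k. Thus the powers of L₀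
make only unessential logarithmic contributions to the constants α_{0,j}, α_{1,j}, ε_j in the definitions."*

WHAT IS PROVED (0 `sorry`, no `def`, no new `Prop`).
§1 THE δ′-CHAIN.  `deltaPrime_chain1` — `δ′_j ≦ (1+β₀)²(k−j)^{β₀}δ′_k` for `j < k ≦ K` along the flow: the SECOND member
   of (2.8) [III] for `δ′ = epsK A₁ p₁` (`flowControl_of_betaSign` at the exponent `p₁`, monotone couplings from `β ≧ 0`)
   with its third member `(1+β₀)(1 + g_k²β′(k−j))^{β₀} ≦ (1+β₀)²(k−j)^{β₀}` (`third_members`); `deltaPrime_chain2` —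
   `≦ (1+β₀)²N₀^{β₀}δ′_k` for `k − j ≦ N₀`; `deltaPrime_chain3` — `N₀δ′_j ≦ (1+β₀)²N₀^{1+β₀}δ′_k`; `deltaPrime_chain4` —
   `< 4N₀²δ′_k` for `β₀ ≦ 1/2`, `N₀ ≧ 1`, `δ′_k > 0` (b01 `n0_delta_bound`).  The closing *"we assume that … N₀ =
   O(log g_k⁻²)"* is an ASSUMPTION in print and is not asserted here.
§2 THE `L₀`-CHAIN.  `pow_N0_le` — `L^{N₀−1} = R_{k−N₀+1} ≦ (L+1)(N₀+1)^{β₀}R_k` from `B15Claim179.IsN0 s k N₀` (sizes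
   `R_j = L^{s_j}` of (2.5)) and the (2.9) chain along the flow (`FlowIneq29` second member × `third_members`, with
   `(N₀−1)^{β₀} ≦ (N₀+1)^{β₀}`; for `N₀ = 1` directly); `L0pow_le` — `L₀^{2N₀} ≦ (1/3)^{N₀}L(L+1)(N₀+1)^{β₀}R_k` under the
   printed `L₀² ≦ (1/3)L`; `L0pow_lt` — `< L(L+1)N₀⁻¹R_k` (b01 `n0_growth` and `(N₀+1)^{β₀} ≦ N₀+1`).
HONEST SCOPE.  Real∕integer bookkeeping along the typed [III] flow (standing unprinted input: the sign `β ≧ 0`, cell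
T09.F); `β₀ ≦ 1/2` for the last δ′-step is (2.6)'s *"β₀ > 0 can be chosen arbitrarily small"*; no geometry.  Value = the
row's printed chains kernel-checked with the printed constants; NOT summit progress.
-/

namespace Literature.MathematicalPhysics.QuantumFieldTheory.Balaban1983to89.B15Claim192Flow

open Literature.MathematicalPhysics.QuantumFieldTheory.Balaban1983to89
open B15.BasicStep B15.Ineq194Flow B15Claim179 B15Claim179Flow B14FlowStep

section AlongFlow

variable (F : Flow) (K : ℕ) {γ β' β₀ : ℝ} {L p₁ r : ℕ}

/-! ## §1. The `δ′`-chain of p. 192 -/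

/-- **p. 192, first step**: *"δ′_j ≦ (1 + β₀)²(k − j)^{β₀}δ′_k"* for `j < k ≦ K` — the `δ′`-instance (`δ′ = epsK A₁ p₁`,
`A₁ ≧ 0`) of the second member of (2.8) [III] with its third member, along a flow solving (I.0.20) in `]0, γ]` with
`0 ≦ β_{j+1}(g_j) ≦ β′` and `SmallnessFor γ β′ β₀ L p₁`. [cite: Balaban1989LargeFieldI, p.192] -/
theorem deltaPrime_chain1 (S : SmallnessFor γ β' β₀ L p₁) {A₁ : ℝ} (hA₁ : 0 ≤ A₁) (hrg : F.SatisfiesRG K)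
    (hI : F.InInterval γ K) (hub : ∀ j, j < K → F.β (j + 1) (F.g j) ≤ β')
    (hlb : ∀ j, j < K → 0 ≤ F.β (j + 1) (F.g j)) {j k : ℕ} (hjk : j < k) (hkK : k ≤ K) :
    deltaPrimeK A₁ p₁ F j ≤ (1 + β₀) ^ 2 * ((k : ℝ) - j) ^ β₀ * deltaPrimeK A₁ p₁ F k := by
  have hI' : Step.InInterval γ K F.g := (Step.inInterval_iff F γ K).mp hI
  have hpos : ∀ i, i ≤ K → 0 < F.g i := fun i hi => (hI i hi).1
  have h26 : B14.FlowIneq26 F.g β' β₀ K :=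
    B14.flowIneq26_of_rg_two_sided F K β' β₀ S.β'_nonneg S.β₀_pos.le hpos hrg hub hlb
  have h28 := flowIneq28_of_26_monotone S hA₁ hI' h26
    (fun m n hmn hnK => g_mono_of_betaNonneg F K hpos hrg hlb hmn hnK)
  obtain ⟨-, h28b⟩ := h28 j k hjk hkK
  obtain ⟨-, h3, -⟩ := third_members S hI' hjk hkK
  have hδk : 0 ≤ deltaPrimeK A₁ p₁ F k := by
    unfold deltaPrimeK p0Profile
    have hk := hpos k hkK
    have := log_inv_sq_nonneg hk (((hI k hkK).2).trans S.γ_lt_one.le)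
    positivity
  unfold deltaPrimeK at hδk ⊢
  calc F.g j * p0Profile A₁ p₁ (F.g j)
      ≤ (1 + β₀) * (1 + F.g k ^ 2 * β' * ((k : ℝ) - j)) ^ β₀ * (F.g k * p0Profile A₁ p₁ (F.g k)) := h28b
    _ ≤ (1 + β₀) ^ 2 * ((k : ℝ) - j) ^ β₀ * (F.g k * p0Profile A₁ p₁ (F.g k)) :=
        mul_le_mul_of_nonneg_right h3 hδk

/-- `δ′_k ≧ 0` along the flow (`0 < g_k ≦ γ < 1`, `A₁ ≧ 0`). [cite: Balaban1989LargeFieldI, (1.27) p.183] -/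
theorem deltaPrimeK_nonneg (S : SmallnessFor γ β' β₀ L p₁) {A₁ : ℝ} (hA₁ : 0 ≤ A₁) (hI : F.InInterval γ K)
    {k : ℕ} (hkK : k ≤ K) : 0 ≤ deltaPrimeK A₁ p₁ F k := by
  unfold deltaPrimeK p0Profile
  have hk := (hI k hkK).1
  have := log_inv_sq_nonneg hk (((hI k hkK).2).trans S.γ_lt_one.le)
  positivity

/-- **p. 192, second step**: *"≦ (1 + β₀)²N₀^{β₀}δ′_k"* — for `k − j ≦ N₀` (the scales `j` of the `N₀` preliminary
integrations below `k`), `(k − j)^{β₀} ≦ N₀^{β₀}`. [cite: Balaban1989LargeFieldI, p.192] -/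
theorem deltaPrime_chain2 (S : SmallnessFor γ β' β₀ L p₁) {A₁ : ℝ} (hA₁ : 0 ≤ A₁) (hrg : F.SatisfiesRG K)
    (hI : F.InInterval γ K) (hub : ∀ j, j < K → F.β (j + 1) (F.g j) ≤ β')
    (hlb : ∀ j, j < K → 0 ≤ F.β (j + 1) (F.g j)) {j k N₀ : ℕ} (hjk : j < k) (hkK : k ≤ K) (hN : k - j ≤ N₀) :
    deltaPrimeK A₁ p₁ F j ≤ (1 + β₀) ^ 2 * (N₀ : ℝ) ^ β₀ * deltaPrimeK A₁ p₁ F k := by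
  have h1 := deltaPrime_chain1 F K S hA₁ hrg hI hub hlb hjk hkK
  have hδk := deltaPrimeK_nonneg F K S hA₁ hI hkK
  have hkj0 : 0 ≤ (k : ℝ) - j := by
    have : (j : ℝ) ≤ k := by exact_mod_cast hjk.le
    linarith
  have hkjN : (k : ℝ) - j ≤ N₀ := by
    have : ((k - j : ℕ) : ℝ) ≤ N₀ := by exact_mod_cast hN
    rw [Nat.cast_sub hjk.le] at this
    exact this
  have hpow : ((k : ℝ) - j) ^ β₀ ≤ (N₀ : ℝ) ^ β₀ := Real.rpow_le_rpow hkj0 hkjN S.β₀_pos.le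
  have h2 : (1 + β₀) ^ 2 * ((k : ℝ) - j) ^ β₀ * deltaPrimeK A₁ p₁ F k
      ≤ (1 + β₀) ^ 2 * (N₀ : ℝ) ^ β₀ * deltaPrimeK A₁ p₁ F k := by
    apply mul_le_mul_of_nonneg_right _ hδk
    exact mul_le_mul_of_nonneg_left hpow (by positivity)
  exact h1.trans h2

/-- **p. 192, third step**: *"so N₀δ′_j ≦ (1 + β₀)²N₀^{1+β₀}δ′_k"* (`N₀ · N₀^{β₀} = N₀^{1+β₀}`). [cite: Balaban1989LargeFieldI, p.192] -/
theorem deltaPrime_chain3 (S : SmallnessFor γ β' β₀ L p₁) {A₁ : ℝ} (hA₁ : 0 ≤ A₁) (hrg : F.SatisfiesRG K)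
    (hI : F.InInterval γ K) (hub : ∀ j, j < K → F.β (j + 1) (F.g j) ≤ β')
    (hlb : ∀ j, j < K → 0 ≤ F.β (j + 1) (F.g j)) {j k N₀ : ℕ} (hjk : j < k) (hkK : k ≤ K) (hN : k - j ≤ N₀) :
    (N₀ : ℝ) * deltaPrimeK A₁ p₁ F j ≤ (1 + β₀) ^ 2 * (N₀ : ℝ) ^ (1 + β₀) * deltaPrimeK A₁ p₁ F k := by
  have h2 := deltaPrime_chain2 F K S hA₁ hrg hI hub hlb hjk hkK hN
  have hN0 : (0 : ℝ) ≤ N₀ := by positivity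
  have h3 := mul_le_mul_of_nonneg_left h2 hN0
  have hpow : (N₀ : ℝ) * (N₀ : ℝ) ^ β₀ = (N₀ : ℝ) ^ (1 + β₀) := by
    rcases eq_or_lt_of_le hN0 with h0 | hpos
    · rw [← h0]
      rw [Real.zero_rpow (by linarith [S.β₀_pos]), Real.zero_rpow (by linarith [S.β₀_pos])]
      ring
    · rw [Real.rpow_add hpos, Real.rpow_one]
  calc (N₀ : ℝ) * deltaPrimeK A₁ p₁ F j
      ≤ (N₀ : ℝ) * ((1 + β₀) ^ 2 * (N₀ : ℝ) ^ β₀ * deltaPrimeK A₁ p₁ F k) := h3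
    _ = (1 + β₀) ^ 2 * ((N₀ : ℝ) * (N₀ : ℝ) ^ β₀) * deltaPrimeK A₁ p₁ F k := by ring
    _ = (1 + β₀) ^ 2 * (N₀ : ℝ) ^ (1 + β₀) * deltaPrimeK A₁ p₁ F k := by rw [hpow]

/-- **p. 192, last step**: *"< 4N₀²δ′_k"* — b01's `B15.BasicStep.n0_delta_bound` (`(1+β₀)²N₀^{1+β₀} < 4N₀²` for
`0 ≦ β₀ ≦ 1/2`, `N₀ ≧ 1`) along the flow, for `δ′_k > 0` (`A₁ > 0`); `β₀ ≦ 1/2` is (2.6)'s *"β₀ > 0 can be chosen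
arbitrarily small"*. [cite: Balaban1989LargeFieldI, p.192] -/
theorem deltaPrime_chain4 (S : SmallnessFor γ β' β₀ L p₁) {A₁ : ℝ} (hA₁ : 0 < A₁) (hβ₀ : β₀ ≤ 1 / 2)
    (hrg : F.SatisfiesRG K) (hI : F.InInterval γ K) (hub : ∀ j, j < K → F.β (j + 1) (F.g j) ≤ β')
    (hlb : ∀ j, j < K → 0 ≤ F.β (j + 1) (F.g j)) {j k N₀ : ℕ} (hjk : j < k) (hkK : k ≤ K) (hN : k - j ≤ N₀)
    (hN1 : 1 ≤ N₀) :
    (N₀ : ℝ) * deltaPrimeK A₁ p₁ F j < 4 * (N₀ : ℝ) ^ 2 * deltaPrimeK A₁ p₁ F k := by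
  have h3 := deltaPrime_chain3 F K S hA₁.le hrg hI hub hlb hjk hkK hN
  have hb := n0_delta_bound (N₀ := (N₀ : ℝ)) S.β₀_pos.le hβ₀ (by exact_mod_cast hN1)
  have hδk : 0 < deltaPrimeK A₁ p₁ F k := by
    unfold deltaPrimeK p0Profile
    obtain ⟨hk0, hkγ⟩ := hI k hkK
    have hlog : 0 < Real.log ((F.g k) ^ 2)⁻¹ := by
      apply Real.log_pos
      have h1 : (F.g k) ^ 2 < 1 := by nlinarith [S.γ_lt_one]
      exact one_lt_inv₀ (by positivity) |>.mpr h1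
    positivity
  have h4 : (1 + β₀) ^ 2 * (N₀ : ℝ) ^ (1 + β₀) * deltaPrimeK A₁ p₁ F k < 4 * (N₀ : ℝ) ^ 2 * deltaPrimeK A₁ p₁ F k :=
    mul_lt_mul_of_pos_right hb hδk
  exact lt_of_le_of_lt h3 h4

/-! ## §2. The `L₀`-chain of p. 192 -/

/-- **p. 192**: *"L^{N₀−1} = R_{k−N₀+1} ≦ (L + 1)(N₀ + 1)^{β₀}R_k"* — along the flow, for sizes `R_j = L^{s_j}` of (2.5)
(exponent `r`, `SmallnessFor γ β′ β₀ L r`) and `N₀` the integer of p. 179 (`B15Claim179.IsN0 s k N₀`): the equality is the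
`N₀`-equation, the inequality the (2.9) chain `R_m ≦ L(1 + g_n²β′(n−m))^{β₀}R_n ≦ (L+1)(n−m)^{β₀}R_n` at
`(m, n) = (k−N₀+1, k)` with `(N₀−1)^{β₀} ≦ (N₀+1)^{β₀}` (for `N₀ = 1` directly). [cite: Balaban1989LargeFieldI, p.192] -/
theorem pow_N0_le (S : SmallnessFor γ β' β₀ L r) (hrg : F.SatisfiesRG K) (hI : F.InInterval γ K)
    (hub : ∀ j, j < K → F.β (j + 1) (F.g j) ≤ β') (hlb : ∀ j, j < K → 0 ≤ F.β (j + 1) (F.g j))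
    {s : ℕ → ℕ} (hs : ∀ j, j ≤ K → B14.IsRj L r (F.g j) (L ^ s j)) {k N₀ : ℕ} (hkK : k ≤ K)
    (hN : IsN0 s k N₀) :
    (L : ℝ) ^ (N₀ - 1) = (L : ℝ) ^ s (k - N₀ + 1) ∧
      (L : ℝ) ^ s (k - N₀ + 1) ≤ ((L : ℝ) + 1) * ((N₀ : ℝ) + 1) ^ β₀ * (L : ℝ) ^ s k := by
  obtain ⟨hmem, -⟩ := hN
  obtain ⟨⟨hN1, hNk⟩, hEq⟩ := mem_sols.1 hmem
  unfold Eq179 at hEq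
  refine ⟨by rw [hEq], ?_⟩
  have hL2 : (2 : ℝ) ≤ L := by exact_mod_cast S.hL
  have hβ0 := S.β₀_pos.le
  have hRk : 0 ≤ (L : ℝ) ^ s k := by positivity
  rcases Nat.lt_or_ge 1 N₀ with hN2 | hN2
  · -- N₀ ≥ 2: (2.9) at (m, n) = (k − N₀ + 1, k)
    have hmn : k - N₀ + 1 < k := by omega
    obtain ⟨-, -, -, h29⟩ := flowControl_of_betaSign F K S (A₀ := 0) le_rfl (fun j => L ^ s j) hs hrg hI hub hlb
    obtain ⟨-, h29b⟩ := h29 (k - N₀ + 1) k hmn hkK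
    have hI' : Step.InInterval γ K F.g := (Step.inInterval_iff F γ K).mp hI
    obtain ⟨-, -, h3c⟩ := third_members S hI' hmn hkK
    have hcast : ((k : ℝ) - ((k - N₀ + 1 : ℕ) : ℝ)) = (N₀ : ℝ) - 1 := by
      rw [Nat.cast_add, Nat.cast_sub hNk]; push_cast; ring
    rw [hcast] at h29b h3c
    push_cast at h29b
    have hN2r : (2 : ℝ) ≤ N₀ := by exact_mod_cast hN2
    have hmono : ((N₀ : ℝ) - 1) ^ β₀ ≤ ((N₀ : ℝ) + 1) ^ β₀ :=
      Real.rpow_le_rpow (by linarith) (by linarith) hβ0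
    calc (L : ℝ) ^ s (k - N₀ + 1)
        ≤ (L : ℝ) * (1 + F.g k ^ 2 * β' * ((N₀ : ℝ) - 1)) ^ β₀ * (L : ℝ) ^ s k := h29b
      _ ≤ ((L : ℝ) + 1) * ((N₀ : ℝ) - 1) ^ β₀ * (L : ℝ) ^ s k := mul_le_mul_of_nonneg_right h3c hRk
      _ ≤ ((L : ℝ) + 1) * ((N₀ : ℝ) + 1) ^ β₀ * (L : ℝ) ^ s k := by
          apply mul_le_mul_of_nonneg_right _ hRk
          exact mul_le_mul_of_nonneg_left hmono (by linarith)
  · -- N₀ = 1: R_k ≤ (L+1)·2^{β₀}·R_k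
    have hN₀ : N₀ = 1 := by omega
    subst hN₀
    have e : k - 1 + 1 = k := by omega
    rw [e]
    have h1 : (1 : ℝ) ≤ ((L : ℝ) + 1) * (((1 : ℕ) : ℝ) + 1) ^ β₀ := by
      have hb : (1 : ℝ) ≤ (((1 : ℕ) : ℝ) + 1) ^ β₀ := Real.one_le_rpow (by norm_num) hβ0
      nlinarith
    calc (L : ℝ) ^ s k = 1 * (L : ℝ) ^ s k := (one_mul _).symm
      _ ≤ ((L : ℝ) + 1) * (((1 : ℕ) : ℝ) + 1) ^ β₀ * (L : ℝ) ^ s k := mul_le_mul_of_nonneg_right h1 hRk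

/-- **p. 192**: *"The number L₀ satisfies the restriction L₀² ≦ (1/3)L, hence L₀^{2N₀} ≦ (1/3)^{N₀}L(L + 1)(N₀ + 1)^{β₀}R_k"*
— from `pow_N0_le` (`L^{N₀} = L·L^{N₀−1}`, `N₀ ≧ 1`) and the printed `L₀² ≦ (1/3)L` (p. 191) (`L₀^{2N₀} = (L₀²)^{N₀}`, no sign of `L₀` needed).
[cite: Balaban1989LargeFieldI, p.192] -/
theorem L0pow_le (S : SmallnessFor γ β' β₀ L r) (hrg : F.SatisfiesRG K) (hI : F.InInterval γ K)
    (hub : ∀ j, j < K → F.β (j + 1) (F.g j) ≤ β') (hlb : ∀ j, j < K → 0 ≤ F.β (j + 1) (F.g j))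
    {s : ℕ → ℕ} (hs : ∀ j, j ≤ K → B14.IsRj L r (F.g j) (L ^ s j)) {k N₀ : ℕ} (hkK : k ≤ K)
    (hN : IsN0 s k N₀) {L₀ : ℝ} (hL₀L : L₀ ^ 2 ≤ (1 / 3) * L) :
    L₀ ^ (2 * N₀) ≤ (1 / 3 : ℝ) ^ N₀ * L * ((L : ℝ) + 1) * ((N₀ : ℝ) + 1) ^ β₀ * (L : ℝ) ^ s k := by
  obtain ⟨heq, hle⟩ := pow_N0_le F K S hrg hI hub hlb hs hkK hN
  obtain ⟨hmem, -⟩ := hN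
  obtain ⟨⟨hN1, -⟩, -⟩ := mem_sols.1 hmem
  have hL0 : (0 : ℝ) ≤ L := by positivity
  -- L₀^{2N₀} = (L₀²)^{N₀} ≤ (L/3)^{N₀} = (1/3)^{N₀} L^{N₀}
  have h1 : L₀ ^ (2 * N₀) ≤ ((1 / 3 : ℝ) * L) ^ N₀ := by
    rw [pow_mul]
    exact pow_le_pow_left₀ (by positivity) hL₀L N₀
  have h2 : ((1 / 3 : ℝ) * L) ^ N₀ = (1 / 3 : ℝ) ^ N₀ * (L * (L : ℝ) ^ (N₀ - 1)) := by
    rw [mul_pow]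
    congr 1
    obtain ⟨t, rfl⟩ : ∃ t, N₀ = t + 1 := ⟨N₀ - 1, by omega⟩
    rw [Nat.add_sub_cancel, pow_succ]; ring
  have h3 : L * (L : ℝ) ^ (N₀ - 1) ≤ L * (((L : ℝ) + 1) * ((N₀ : ℝ) + 1) ^ β₀ * (L : ℝ) ^ s k) := by
    rw [heq]
    exact mul_le_mul_of_nonneg_left hle hL0
  calc L₀ ^ (2 * N₀) ≤ ((1 / 3 : ℝ) * L) ^ N₀ := h1
    _ = (1 / 3 : ℝ) ^ N₀ * (L * (L : ℝ) ^ (N₀ - 1)) := h2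
    _ ≤ (1 / 3 : ℝ) ^ N₀ * (L * (((L : ℝ) + 1) * ((N₀ : ℝ) + 1) ^ β₀ * (L : ℝ) ^ s k)) :=
        mul_le_mul_of_nonneg_left h3 (by positivity)
    _ = (1 / 3 : ℝ) ^ N₀ * L * ((L : ℝ) + 1) * ((N₀ : ℝ) + 1) ^ β₀ * (L : ℝ) ^ s k := by ring

/-- **p. 192, last step**: *"(1/3)^{N₀}L(L + 1)(N₀ + 1)^{β₀}R_k < L(L + 1)N₀^{−1}R_k"* — i.e. `N₀(N₀+1)^{β₀} < 3^{N₀}`, from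
b01's `B15.BasicStep.n0_growth` (`N₀(N₀+1) < 3^{N₀}`) and `(N₀+1)^{β₀} ≦ N₀+1` (`β₀ ≦ 1`); `L ≧ 2`, `R_k = L^{s_k} ≧ 1`,
`N₀ ≧ 1`. [cite: Balaban1989LargeFieldI, p.192] -/
theorem L0pow_lt {L : ℕ} (hL : 2 ≤ L) {β₀ : ℝ} (hβ1 : β₀ ≤ 1) {N₀ : ℕ} (hN1 : 1 ≤ N₀)
    (s : ℕ → ℕ) (k : ℕ) :
    (1 / 3 : ℝ) ^ N₀ * L * ((L : ℝ) + 1) * ((N₀ : ℝ) + 1) ^ β₀ * (L : ℝ) ^ s k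
      < L * ((L : ℝ) + 1) * (N₀ : ℝ)⁻¹ * (L : ℝ) ^ s k := by
  have hL2 : (2 : ℝ) ≤ L := by exact_mod_cast hL
  have hN : (1 : ℝ) ≤ N₀ := by exact_mod_cast hN1
  have hgrowth : (N₀ : ℝ) * ((N₀ : ℝ) + 1) < (3 : ℝ) ^ N₀ := by exact_mod_cast n0_growth N₀ hN1
  have hrpow : ((N₀ : ℝ) + 1) ^ β₀ ≤ (N₀ : ℝ) + 1 := by
    calc ((N₀ : ℝ) + 1) ^ β₀ ≤ ((N₀ : ℝ) + 1) ^ (1 : ℝ) := Real.rpow_le_rpow_of_exponent_le (by linarith) hβ1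
      _ = (N₀ : ℝ) + 1 := Real.rpow_one _
  have hrpow0 : 0 ≤ ((N₀ : ℝ) + 1) ^ β₀ := by positivity
  -- N₀ (N₀+1)^{β₀} < 3^{N₀}, i.e. (1/3)^{N₀} (N₀+1)^{β₀} < N₀⁻¹
  have hkey : (1 / 3 : ℝ) ^ N₀ * ((N₀ : ℝ) + 1) ^ β₀ < (N₀ : ℝ)⁻¹ := by
    have h3 : (0 : ℝ) < (3 : ℝ) ^ N₀ := by positivity
    have hN0 : (0 : ℝ) < N₀ := by linarith
    have h1 : (N₀ : ℝ) * ((N₀ : ℝ) + 1) ^ β₀ < (3 : ℝ) ^ N₀ := by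
      calc (N₀ : ℝ) * ((N₀ : ℝ) + 1) ^ β₀ ≤ (N₀ : ℝ) * ((N₀ : ℝ) + 1) :=
            mul_le_mul_of_nonneg_left hrpow hN0.le
        _ < (3 : ℝ) ^ N₀ := hgrowth
    have hlt : ((N₀ : ℝ) + 1) ^ β₀ < (3 : ℝ) ^ N₀ / N₀ := by
      rw [lt_div_iff₀ hN0]; linarith
    calc (1 / 3 : ℝ) ^ N₀ * ((N₀ : ℝ) + 1) ^ β₀ = ((N₀ : ℝ) + 1) ^ β₀ / (3 : ℝ) ^ N₀ := by
          rw [one_div_pow]; ring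
      _ < ((3 : ℝ) ^ N₀ / N₀) / (3 : ℝ) ^ N₀ := div_lt_div_of_pos_right hlt h3
      _ = (N₀ : ℝ)⁻¹ := by field_simp
  have hpos : (0 : ℝ) < L * ((L : ℝ) + 1) * (L : ℝ) ^ s k := by positivity
  calc (1 / 3 : ℝ) ^ N₀ * L * ((L : ℝ) + 1) * ((N₀ : ℝ) + 1) ^ β₀ * (L : ℝ) ^ s k
      = ((1 / 3 : ℝ) ^ N₀ * ((N₀ : ℝ) + 1) ^ β₀) * (L * ((L : ℝ) + 1) * (L : ℝ) ^ s k) := by ring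
    _ < (N₀ : ℝ)⁻¹ * (L * ((L : ℝ) + 1) * (L : ℝ) ^ s k) := mul_lt_mul_of_pos_right hkey hpos
    _ = L * ((L : ℝ) + 1) * (N₀ : ℝ)⁻¹ * (L : ℝ) ^ s k := by ring

/-- **p. 192, the whole `L₀`-chain along the flow**: `L₀^{2N₀} < L(L+1)N₀⁻¹R_k` under `L₀² ≦ (1/3)L`.
[cite: Balaban1989LargeFieldI, p.192] -/
theorem L0pow_chain (S : SmallnessFor γ β' β₀ L r) (hrg : F.SatisfiesRG K) (hI : F.InInterval γ K)
    (hub : ∀ j, j < K → F.β (j + 1) (F.g j) ≤ β') (hlb : ∀ j, j < K → 0 ≤ F.β (j + 1) (F.g j))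
    {s : ℕ → ℕ} (hs : ∀ j, j ≤ K → B14.IsRj L r (F.g j) (L ^ s j)) {k N₀ : ℕ} (hkK : k ≤ K)
    (hN : IsN0 s k N₀) {L₀ : ℝ} (hL₀L : L₀ ^ 2 ≤ (1 / 3) * L) :
    L₀ ^ (2 * N₀) < L * ((L : ℝ) + 1) * (N₀ : ℝ)⁻¹ * (L : ℝ) ^ s k := by
  have h1 := L0pow_le F K S hrg hI hub hlb hs hkK hN hL₀L
  obtain ⟨hmem, -⟩ := hN
  obtain ⟨⟨hN1, -⟩, -⟩ := mem_sols.1 hmem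
  exact lt_of_le_of_lt h1 (L0pow_lt S.hL S.β₀_le_one hN1 s k)

end AlongFlow

end Literature.MathematicalPhysics.QuantumFieldTheory.Balaban1983to89.B15Claim192Flow
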